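import Summits.CriticalPhenomena.CardyFormulaZ2.Theorems.CardyBoundaryCoulombGasBoundaryDefectGaussianRStubRealisabilityPart26
import Summits.CriticalPhenomena.CardyFormulaZ2.Theorems.CardyBoundaryCoulombGasBoundaryDefectGaussianRStubRealisabilityPart31
import Summits.CriticalPhenomena.CardyFormulaZ2.Theorems.CardyBoundaryCoulombGasBoundaryDefectGaussianRStubRealisabilityPart42
import Literature.Probability.LatticeModels.CornerPermutation
import Literature.Probability.LatticeModels.MedialInterfaceProofs

/-!
# Stub `stub_realisability` of line `rainbow-monomials-in-excursion-kernels` — Part 41: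
# Lemma V (unit height differences) of the insertion dictionary D2 — I: faces and darts around a
# vertex, the boundary cycle by indices, footprints of the walk
# (crux `BoundaryDefectGaussianR`, stmt-CriticalPhenomena-14132)

Lemma V of the lead's D2 roadmap (statement and proof outline: Part 46): every valid height
configuration of the jump collar `ι.model V` of an admissible leg insertion
(`Literature.Probability.LatticeModels.CollarLegModel`) has unit height differences at every
tracked corner, under flat insertion points and `√8`-charts. This part collects the tools:
* transport of (non-)membership along `abel` identities, lattice neighbours, `Fin 4` arithmetic;
* faces and darts around a vertex: `gapFace (x, j)` is the `j`-th face at `x`, its corners, the same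
  face from its other corners (`gapFace_corner`, `gapFace_eq_gapFace_iff`; the corners `mem_faceCorners_gapFace` are Part 13's), **uniqueness of the
  exterior dart of a face** (`exterior_dart_unique`, registered as `s13_exteriorDartUnique`) and the
  **predecessor of an exterior dart** (`exists_pred_dart`: turn / straight / turn back);
* the boundary cycle by indices: successor `(t + 1) % P`, predecessor, closure under predecessors,
  injectivity (`cycle_succ`, `cycle_pred`, `cycle_pred_of_dsucc`, `cycle_inj`), on Part 5 of stub 3
  (the seam `st_mod_succ` and exterior darts `cycle_getElem_exterior` are Parts 31 / 13);
* **footprints by position** (`pending_footprint`, `active_footprint`; cf. Part 31's variants).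
-/

namespace Summit.CriticalPhenomena.CardyFormulaZ2.Cruxes.BoundaryDefectGaussianR.RainbowMonomialsInExcursionKernels

open Literature.Probability.LatticeModels Literature.Probability.LatticeModels.CollarLegModel

/-- The four elements of `Fin 4` (file-local copy). [folklore] -/
private theorem fin4_cases (i : Fin 4) : i = 0 ∨ i = 1 ∨ i = 2 ∨ i = 3 := by fin_cases i <;> simp

/-! ### Small tools: `Fin 4` arithmetic, transport of membership, neighbours -/

section Tools

variable {V : Finset (ℤ × ℤ)}


/-- Transport of non-membership along an identity of lattice points (used with `abel`). [folklore] -/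
theorem nmem_of_eq {P Q : ℤ × ℤ} (h : Q ∉ V) (e : P = Q) : P ∉ V := by rw [e]; exact h

/-- Transport of membership along an identity of lattice points (used with `abel`). [folklore] -/
theorem mem_of_eq {P Q : ℤ × ℤ} (h : Q ∈ V) (e : P = Q) : P ∈ V := by rw [e]; exact h

/-- Lattice neighbours are the points `y + dir j`. [folklore] -/
theorem mem_neighbours_iff {y g : ℤ × ℤ} : g ∈ neighbours y ↔ ∃ j : Fin 4, g = y + dir j := by
  constructor
  · intro h
    simp only [neighbours, Finset.mem_insert, Finset.mem_singleton] at h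
    rcases h with rfl | rfl | rfl | rfl
    · exact ⟨0, by rw [dir_zero]; ext <;> simp⟩
    · exact ⟨1, by rw [dir_one]; ext <;> simp⟩
    · exact ⟨2, by rw [dir_two]; ext <;> simp; ring⟩
    · exact ⟨3, by rw [dir_three]; ext <;> simp; ring⟩
  · rintro ⟨j, rfl⟩
    obtain ⟨y1, y2⟩ := y
    rcases fin4_cases j with rfl | rfl | rfl | rfl <;> simp [neighbours] <;> ring_nf

end Tools


/-! ### Faces and darts around a vertex -/

section Faces

/-- The gap face of `(x, j)` is the `j`-th face around `x` in the indexing of `mem_vertexFaces_iff`. [folklore] -/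
theorem gapFace_mk (x : ℤ × ℤ) (j : Fin 4) :
    gapFace (x, j) = ![x, (x.1 - 1, x.2), (x.1 - 1, x.2 - 1), (x.1, x.2 - 1)] j := rfl

/-- The faces at `x` are the gap faces of the four darts at `x`. [folklore] -/
theorem mem_vertexFaces_iff_gapFace {x f : ℤ × ℤ} : f ∈ SixVertex.vertexFaces x ↔ ∃ j : Fin 4, f = gapFace (x, j) :=
  mem_vertexFaces_iff

/-- A face none of whose corners is in `V` is not a face of `V`. [folklore] -/
theorem not_mem_faces_of_corners {V : Finset (ℤ × ℤ)} {f : ℤ × ℤ} (h : ∀ v ∈ SixVertex.faceCorners f, v ∉ V) :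
    f ∉ SixVertex.faces V := by
  intro hf
  obtain ⟨v, hv, hvf⟩ := Finset.mem_biUnion.mp hf
  exact h v (se_mem_faceCorners_of_mem_vertexFaces hvf) hv

/-- The same face seen from its other three corners. [folklore] -/
theorem gapFace_corner (x : ℤ × ℤ) (j : Fin 4) :
    gapFace (x + dir j, j + 1) = gapFace (x, j) ∧ gapFace (x + dir j + dir (j + 1), j + 2) = gapFace (x, j) ∧
      gapFace (x + dir (j + 1), j + 3) = gapFace (x, j) := by
  obtain ⟨x1, x2⟩ := x
  fin_cases j <;> simp [gapFace, Prod.ext_iff] <;> omega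

/-- A face and a corner position determine the dart: `gapFace (v, i) = gapFace (x, j)` forces
`(v, i)` to be one of the four (corner, position) pairs of that face. [folklore] -/
theorem gapFace_eq_gapFace_iff {x v : ℤ × ℤ} {i j : Fin 4} :
    gapFace (v, i) = gapFace (x, j) ↔
      (i = j ∧ v = x) ∨ (i = j + 1 ∧ v = x + dir j) ∨ (i = j + 2 ∧ v = x + dir j + dir (j + 1)) ∨
        (i = j + 3 ∧ v = x + dir (j + 1)) := by
  constructor
  · intro h
    obtain ⟨x1, x2⟩ := x
    obtain ⟨v1, v2⟩ := v
    fin_cases i <;> fin_cases j <;> simp [gapFace, Prod.ext_iff] at h ⊢ <;> omega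
  · rintro (⟨rfl, rfl⟩ | ⟨rfl, rfl⟩ | ⟨rfl, rfl⟩ | ⟨rfl, rfl⟩)
    · rfl
    · exact (gapFace_corner x j).1
    · exact (gapFace_corner x j).2.1
    · exact (gapFace_corner x j).2.2

/-- The gap face of an exterior dart is an exterior face-cell (a corner in `V`, a corner outside). [folklore] -/
theorem gapFace_mem_bdryFaces {V : Finset (ℤ × ℤ)} {x : ℤ × ℤ} {j : Fin 4} (hx : x ∈ V) (hj : x + dir j ∉ V) :
    gapFace (x, j) ∈ SixVertex.bdryFaces V ∧ gapFace (x, j) ∉ interiorFaces V := by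
  have hc : ¬ SixVertex.faceCorners (gapFace (x, j)) ⊆ V :=
    fun h => hj (h ((mem_faceCorners_gapFace _ _ _).mpr (Or.inr (Or.inl rfl))))
  have hf : gapFace (x, j) ∈ SixVertex.faces V :=
    Finset.mem_biUnion.mpr ⟨x, hx, mem_vertexFaces_iff_gapFace.mpr ⟨j, rfl⟩⟩
  exact ⟨Finset.mem_filter.mpr ⟨hf, hc⟩, fun h => hc (Finset.mem_filter.mp h).2⟩

/-- A face all of whose four corners are in `V` is an interior face. [folklore] -/
theorem gapFace_mem_interiorFaces {V : Finset (ℤ × ℤ)} {x : ℤ × ℤ} {j : Fin 4} (hx : x ∈ V) (h1 : x + dir j ∈ V)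
    (h2 : x + dir (j + 1) ∈ V) (h3 : x + dir j + dir (j + 1) ∈ V) : gapFace (x, j) ∈ interiorFaces V := by
  refine Finset.mem_filter.mpr ⟨Finset.mem_biUnion.mpr ⟨x, hx, mem_vertexFaces_iff_gapFace.mpr ⟨j, rfl⟩⟩, ?_⟩
  intro v hv
  rcases (mem_faceCorners_gapFace _ _ _).mp hv with rfl | rfl | rfl | rfl <;> assumption

/-- **Uniqueness of the dart of a face.** An exterior dart `(x, k)` whose convex side is not
diagonally pinched (`x + dir (k+1) ∉ V ⇒ x + dir k + dir (k+1) ∉ V`) is the ONLY exterior dart with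
its gap face. [folklore] -/
theorem exterior_dart_unique {V : Finset (ℤ × ℤ)} {x v : ℤ × ℤ} {k i : Fin 4} (hx : x ∈ V) (hk : x + dir k ∉ V)
    (h5 : x + dir (k + 1) ∉ V → x + dir k + dir (k + 1) ∉ V) (hv : v ∈ V) (hi : v + dir i ∉ V)
    (h : gapFace (v, i) = gapFace (x, k)) : (v, i) = (x, k) := by
  rcases gapFace_eq_gapFace_iff.mp h with ⟨rfl, rfl⟩ | ⟨rfl, rfl⟩ | ⟨rfl, rfl⟩ | ⟨rfl, rfl⟩
  · rfl
  · exact absurd hv hk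
  · have e : x + dir k + dir (k + 1) + dir (k + 2) = x + dir (k + 1) := by rw [tp_dir_add_two]; abel
    rw [e] at hi
    exact absurd hv (h5 hi)
  · have e : x + dir (k + 1) + dir (k + 3) = x := by rw [tp_dir_add_three]; abel
    rw [e] at hi
    exact absurd hx hi

/-- **The predecessor of an exterior dart.** Every exterior dart `(x, k)` is the successor of an
exterior dart `e` whose gap face is the face `k + 3` at `x` (before the dart): `e` turns at `x`,
comes straight from `x - dir (k+1)`, or turns back from `x - dir (k+1) + dir k`. [folklore] -/
theorem exists_pred_dart {V : Finset (ℤ × ℤ)} {x : ℤ × ℤ} {k : Fin 4} (hx : x ∈ V) (hk : x + dir k ∉ V) :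
    ∃ e : Dart, e.1 ∈ V ∧ dartTip e ∉ V ∧ dsucc V e = (x, k) ∧ gapFace e = gapFace (x, k + 3) ∧
      ((e = (x, k + 3) ∧ x + dir (k + 3) ∉ V) ∨
       (e = (x + dir (k + 3), k) ∧ x + dir (k + 3) ∈ V ∧ x + dir (k + 3) + dir k ∉ V) ∨
       (e = (x + dir (k + 3) + dir k, k + 1) ∧ x + dir (k + 3) ∈ V ∧ x + dir (k + 3) + dir k ∈ V)) := by
  have f1 : k + 3 + 1 = k := (by decide : ∀ k : Fin 4, k + 3 + 1 = k) k
  have f2 : k + 3 + 2 = k + 1 := (by decide : ∀ k : Fin 4, k + 3 + 2 = k + 1) k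
  have f3 : k + 1 + 1 = k + 2 := (by decide : ∀ k : Fin 4, k + 1 + 1 = k + 2) k
  by_cases h1 : x + dir (k + 3) ∈ V
  · by_cases h2 : x + dir (k + 3) + dir k ∈ V
    · refine ⟨(x + dir (k + 3) + dir k, k + 1), h2, ?_, ?_, ?_, Or.inr (Or.inr ⟨rfl, h1, h2⟩)⟩
      · rw [dartTip_mk]
        have e : x + dir (k + 3) + dir k + dir (k + 1) = x + dir k := by rw [tp_dir_add_three]; abel
        rwa [e]
      · have eA : x + dir (k + 3) + dir k + dir (k + 1 + 1) = x + dir (k + 3) := by rw [f3, tp_dir_add_two]; abel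
        have eB : x + dir (k + 3) + dir (k + 1) = x := by rw [tp_dir_add_three]; abel
        have e3 : k + 1 + 3 = k := (by decide : ∀ k : Fin 4, k + 1 + 3 = k) k
        simp only [dsucc, eA, h1, not_true_eq_false, if_false, eB, hx, e3]
      · have := (gapFace_corner x (k + 3)).2.1
        rwa [f1, f2] at this
    · refine ⟨(x + dir (k + 3), k), h1, by rwa [dartTip_mk], ?_, ?_, Or.inr (Or.inl ⟨rfl, h1, h2⟩)⟩
      · have eB : x + dir (k + 3) + dir (k + 1) = x := by rw [tp_dir_add_three]; abel
        simp only [dsucc, eB, hx, not_true_eq_false, if_false, hk, not_false_eq_true, if_true]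
      · have := (gapFace_corner x (k + 3)).1
        rwa [f1] at this
  · refine ⟨(x, k + 3), hx, by rwa [dartTip_mk], ?_, rfl, Or.inl ⟨rfl, h1⟩⟩
    simp only [dsucc, f1, hk, not_false_eq_true, if_true]

end Faces


/-! ### The boundary cycle by indices (successor / predecessor modulo the period) -/

section Cycle

variable {V : Finset (ℤ × ℤ)} {d₀ : Dart}

variable (hv₀ : d₀.1 ∈ V) (ht₀ : dartTip d₀ ∉ V)
include hv₀ ht₀

/-- Distinct indices carry distinct darts. [folklore] -/
theorem cycle_inj {s t : ℕ} {hs : s < (cycle V d₀).length} {ht : t < (cycle V d₀).length}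
    (h : (cycle V d₀)[s] = (cycle V d₀)[t]) : s = t :=
  (List.Nodup.getElem_inj_iff (s3_cycle_orbit V d₀ hv₀ ht₀).2.2.2.1).1 h

/-- **Successor.** The dart after index `t` (index `t + 1` modulo the period) is `dsucc` of dart `t`. [folklore] -/
theorem cycle_succ {t : ℕ} (ht : t < (cycle V d₀).length) :
    (cycle V d₀)[(t + 1) % (cycle V d₀).length]'(Nat.mod_lt _ (by omega)) = dsucc V (cycle V d₀)[t] := by
  obtain ⟨hP0, -, hret, -⟩ := s3_period_spec V d₀ hv₀ ht₀
  rw [se_cycle_getElem, se_cycle_getElem, ← Function.iterate_succ_apply' (dsucc V)]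
  by_cases h : t + 1 < (cycle V d₀).length
  · rw [Nat.mod_eq_of_lt h]
  · have hlen : (cycle V d₀).length = period V d₀ := by simp [cycle]
    have hP : t + 1 = period V d₀ := by rw [hlen] at ht h; omega
    rw [hlen, hP, Nat.mod_self, Function.iterate_zero, id_eq, Nat.succ_eq_add_one, hP, hret]

/-- The index after `s` is determined by the dart after `s`. [folklore] -/
theorem cycle_succ_unique {s t : ℕ} (hs : s < (cycle V d₀).length) (ht : t < (cycle V d₀).length)
    (h : dsucc V (cycle V d₀)[s] = (cycle V d₀)[t]) : (s + 1) % (cycle V d₀).length = t := by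
  rw [← cycle_succ hv₀ ht₀ hs] at h
  exact cycle_inj hv₀ ht₀ h

/-- **Predecessor.** Every index `t` is the successor of the index `(t + P - 1) % P`. [folklore] -/
theorem cycle_pred {t : ℕ} (ht : t < (cycle V d₀).length) :
    ∃ s, ∃ hs : s < (cycle V d₀).length, (s + 1) % (cycle V d₀).length = t ∧
      dsucc V (cycle V d₀)[s] = (cycle V d₀)[t] := by
  set P := (cycle V d₀).length with hP
  have hs : (t + P - 1) % P < P := Nat.mod_lt _ (by omega)
  have hmod : ((t + P - 1) % P + 1) % P = t := by
    rcases Nat.eq_zero_or_pos t with rfl | htpos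
    · have : (0 + P - 1) % P = P - 1 := by rw [Nat.zero_add, Nat.mod_eq_of_lt (by omega)]
      rw [this, Nat.sub_add_cancel (by omega), Nat.mod_self]
    · have : (t + P - 1) % P = t - 1 := by
        rw [show t + P - 1 = (t - 1) + P by omega, Nat.add_mod_right, Nat.mod_eq_of_lt (by omega)]
      rw [this, Nat.sub_add_cancel htpos, Nat.mod_eq_of_lt ht]
  refine ⟨(t + P - 1) % P, hs, hmod, ?_⟩
  have hc : ∀ {i j : ℕ} (hi : i < (cycle V d₀).length) (hj : j < (cycle V d₀).length), i = j →
      (cycle V d₀)[i] = (cycle V d₀)[j] := by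
    intro i j hi hj h; subst h; rfl
  rw [← cycle_succ hv₀ ht₀ hs]
  exact hc _ ht hmod

/-- **Closure under predecessors, by index.** An exterior dart whose successor is dart `t` is the
dart at the index before `t`. [folklore] -/
theorem cycle_pred_of_dsucc {e : Dart} (he : e.1 ∈ V) (het : dartTip e ∉ V) {t : ℕ}
    (ht : t < (cycle V d₀).length) (h : dsucc V e = (cycle V d₀)[t]) :
    ∃ s, ∃ hs : s < (cycle V d₀).length, (s + 1) % (cycle V d₀).length = t ∧ (cycle V d₀)[s] = e := by
  have hmem : e ∈ cycle V d₀ :=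
    (s3_cycle_orbit V d₀ hv₀ ht₀).2.2.2.2.1 e he het (h ▸ List.getElem_mem ht)
  obtain ⟨s, hs, hse⟩ := List.mem_iff_getElem.1 hmem
  refine ⟨s, hs, cycle_succ_unique hv₀ ht₀ hs ht ?_, hse⟩
  rw [hse, h]

end Cycle

/-! ### The walk states around the wrap and the footprint of an insertion -/

section Walk

variable (ι : LegInsertionData) (V : Finset (ℤ × ℤ)) {d₀ : Dart} (hadm : ι.IsAdmissible V)
  (h0 : outDart V ι.sink = some d₀) {st : ℕ → WalkState}
  (hst : ∀ t, st t = List.foldl (fun s d => s.step (ι.startAt V d)) ι.init ((cycle V d₀).take t))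

include hadm in
/-- An insertion announced at a dart has between `1` and `sinkLegs` legs, and sits at an insertion
point with exactly one outside neighbour. [folklore] -/
theorem startAt_some {d : Dart} {Ls : ℕ} {σ : ℤ} (h : ι.startAt V d = some (Ls, σ)) :
    1 ≤ Ls ∧ Ls ≤ ι.sinkLegs ∧ d.1 ∈ insert ι.sink ι.source ∧
      ((neighbours d.1).filter fun y => y ∉ V).card = 1 := by
  have hadm' := hadm
  obtain ⟨-, hlegs, -, h4, -⟩ := hadm'
  have hd : d.1 ∈ insert ι.sink ι.source ∧ 1 ≤ Ls ∧ Ls ≤ ι.sinkLegs := by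
    unfold LegInsertionData.startAt at h
    split_ifs at h with h1 h2
    · simp only [Option.some.injEq, Prod.mk.injEq] at h
      obtain ⟨rfl, -⟩ := h
      have hd1 : d.1 = ι.sink := by
        have := s3_outDart_some V ι.sink d h1
        exact this.1
      exact ⟨hd1 ▸ Finset.mem_insert_self _ _, sinkLegs_pos ι V hadm, le_rfl⟩
    · simp only [Option.some.injEq, Prod.mk.injEq] at h
      obtain ⟨rfl, -⟩ := h
      exact ⟨Finset.mem_insert_of_mem h2.1, hlegs _ h2.1,
        Finset.single_le_sum (f := ι.legs) (fun _ _ => Nat.zero_le _) h2.1⟩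
  exact ⟨hd.2.1, hd.2.2, hd.1, (h4 _ hd.1).2.1⟩

include hst in
/-- **Footprints, by position.** If legs are pending after `t` darts, an insertion `(Ls, σ)` was
announced at some dart `s < t` with `t - s + pending ≤ Ls`. [folklore] -/
theorem pending_footprint : ∀ {t : ℕ}, t ≤ (cycle V d₀).length → 0 < (st t).pending →
    ∃ s, s < t ∧ ∃ Ls σ, ι.startAt V (cycle V d₀)[s]! = some (Ls, σ) ∧ t - s + (st t).pending ≤ Ls
  | 0, _, hp => by rw [hst 0] at hp; simp [LegInsertionData.init] at hp
  | t + 1, ht, hp => by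
    have hlt : t < (cycle V d₀).length := by omega
    have hsucc : st (t + 1) = (st t).step (ι.startAt V ((cycle V d₀)[t]'hlt)) := st_succ ι V hst hlt
    have hget : (cycle V d₀)[t]! = (cycle V d₀)[t]'hlt := getElem!_pos (cycle V d₀) t hlt
    rcases hsa : ι.startAt V ((cycle V d₀)[t]'hlt) with _ | ⟨Ls, σ⟩
    · rw [hsa] at hsucc
      have hle := pending_step_none_le (st t)
      rw [← hsucc] at hle
      have hp' : 0 < (st t).pending := by omega
      obtain ⟨s, hs, Ls, σ, hsome, hbd⟩ := pending_footprint (t := t) (by omega) hp'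
      exact ⟨s, by omega, Ls, σ, hsome, by omega⟩
    · rw [hsa] at hsucc
      have hle := pending_step_some_le (st t) Ls σ
      rw [← hsucc] at hle
      exact ⟨t, by omega, Ls, σ, by rw [hget, hsa], by omega⟩

include hadm hst in
/-- **Active darts lie in footprints.** If dart `t` changes the level or the wiredness, an insertion
`(Ls, σ)` was announced at some dart `s ≤ t` with `t - s + 1 ≤ Ls`. [folklore] -/
theorem active_footprint {t : ℕ} (ht : t < (cycle V d₀).length)
    (hne : ¬ ((st (t + 1)).level = (st t).level ∧ (st (t + 1)).wired = (st t).wired)) :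
    ∃ s, s ≤ t ∧ ∃ Ls σ, ι.startAt V (cycle V d₀)[s]! = some (Ls, σ) ∧ t - s + 1 ≤ Ls := by
  have hsucc : st (t + 1) = (st t).step (ι.startAt V ((cycle V d₀)[t]'ht)) := st_succ ι V hst ht
  have hget : (cycle V d₀)[t]! = (cycle V d₀)[t]'ht := getElem!_pos (cycle V d₀) t ht
  rcases hsa : ι.startAt V ((cycle V d₀)[t]'ht) with _ | ⟨Ls, σ⟩
  · rw [hsa] at hsucc
    by_cases hp : (st t).pending = 0
    · rw [step_none_of_pending _ hp] at hsucc
      exact absurd ⟨congrArg WalkState.level hsucc, congrArg WalkState.wired hsucc⟩ hne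
    · obtain ⟨s, hs, Ls, σ, hsome, hbd⟩ := pending_footprint ι V hst ht.le (Nat.pos_of_ne_zero hp)
      exact ⟨s, hs.le, Ls, σ, hsome, by omega⟩
  · have h1 := (startAt_some ι V hadm hsa).1
    exact ⟨t, le_rfl, Ls, σ, by rw [hget, hsa], by omega⟩

end Walk

/-! ### Registered one-line form -/

/-- **Sub-goal `s13_exteriorDartUnique`** (registered on stmt-CriticalPhenomena-14132): an exterior
dart `(x, k)` of `V` whose convex side is not diagonally pinched is the only exterior dart of `V`
with its gap face — the uniqueness behind "a collar face is met once by the walk". [folklore] -/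
theorem s13_exteriorDartUnique : ∀ (V : Finset (ℤ × ℤ)) (x v : ℤ × ℤ) (k i : Fin 4), x ∈ V → x + Literature.Probability.LatticeModels.CollarLegModel.dir k ∉ V → (x + Literature.Probability.LatticeModels.CollarLegModel.dir (k + 1) ∉ V → x + Literature.Probability.LatticeModels.CollarLegModel.dir k + Literature.Probability.LatticeModels.CollarLegModel.dir (k + 1) ∉ V) → v ∈ V → v + Literature.Probability.LatticeModels.CollarLegModel.dir i ∉ V → Literature.Probability.LatticeModels.CollarLegModel.gapFace (v, i) = Literature.Probability.LatticeModels.CollarLegModel.gapFace (x, k) → (v, i) = (x, k) :=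
  fun _ _ _ _ _ hx hk h5 hv hi h => exterior_dart_unique hx hk h5 hv hi h

end Summit.CriticalPhenomena.CardyFormulaZ2.Cruxes.BoundaryDefectGaussianR.RainbowMonomialsInExcursionKernels
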